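import Summits.CriticalPhenomena.PercolationContinuityZ3.Theorems.PercNearOneGluingNoHeavyLowerTailSahiE3ExchangeNested
import Mathlib.Tactic.Linarith
import Mathlib.Tactic.Ring
import Mathlib.Tactic.Positivity
import HarnessLib
import HarnessLib.Audit

/-!
# `NoHeavyLowerTail` (crux stmt-CriticalPhenomena-4575), Sahi programme P4: the 2×2 exchange lemma — the DOM packing and the principal-slot class

Support file (cell `prim-l12`, seat P4, generation 22; `--supports stmt-CriticalPhenomena-4575`).  No named facts, no sorries;
standard axioms; def-free.

Context (HOME prim-l12-p4/FROM-prim-l12-p4-gen22-SATURATION.md; predecessors `…SahiE3ExchangeCross` (Ξ = ∅),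
`…SahiE3ExchangeEmptyLayer`, `…SahiE3ExchangeSubpairs`, `…SahiE3ExchangeNested`).  The exchange lemma asks, for a Harris block
`(B, w, V)` (`v = w(V)`, `a(X) = w(X∩V)`, `need(X,Y) = w(X)a(Y) + w(Y)a(X) − v·w(X)w(Y)`), a pair-certificate `R ≥ 0` on `V` and a
configuration `O ⊆ K∩L`, `K∪L ⊆ P` (and primed), that
`X_a + R(KK'V) + R(LL'V) − need(K,L') − need(L,K') + (1−v)·Y ≥ 0`, `X_a = a(PP') + a(OO') − w(P)a(O') − w(P')a(O)`,
for the nonnegative bracket values `Y` of the OR-peel.  Generation 22 found (numerically, ≈ 4·10⁷ configurations, n ≤ 5, and an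
exhaustive n = 3 census) that the SAME-FOOTPRINT packing suffices: `R(KK'V) ≥ max(need(K̂,K̂'), a(KK'V))`, `R(LL'V) ≥
max(need(L̂,L̂'), a(LL'V))` with `K̂` the largest up-set having the trace `K∩V` (conjecture H of the memo).  This file proves the
DOM branch of that packing in closed form:

* `exchange_of_dom`: if the four pairs `(K,K')`, `(L,L')`, `(P,P')`, `(O,O')` are nonnegatively correlated CONDITIONALLY ON THE SLOT,
  `v·a(X∩Y∩V) ≥ a(X)·a(Y)`, then the two "dom" inequalities `R(KK'V) ≥ a(KK'V)`, `R(LL'V) ≥ a(LL'V)` (the pair inequality at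
  `(K∩K', B)`, `(L∩L', B)`) already give the exchange expression `≥ 0`, for every bracket value `Y ≥ 0` and in every class
  (no condition on the corners `O`, `O'`, no condition on the crossing cells).  The proof is the identity
  `v·need(X,Y) = a(X)a(Y) − κ(X)κ(Y)` (`κ(X) = a(X) − v·w(X) ≥ 0` by Harris) and
  `v·X_a ≥ (a(P)−a(O))(a(P')−a(O')) ≥ |a(K)−a(L)|·|a(K')−a(L')|`.
* The conditional-Harris hypotheses hold whenever `w(·|V)` is positively associated — in particular for every PRINCIPAL slot
  `V = ↑t` of a product of two-point spaces (a conjunction `x_{i₁}∧⋯∧x_{i_j}`: `V` is a sub-cube and `w(·|V)` a product measure), so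
  the exchange lemma holds for principal slots, all configurations and ALL `R ∈ P_L(V)` (indeed for all `R` dominating `a` on the
  two same-footprints).  For non-principal `V` the conditional correlations can be negative; the defect is what the hatted pairs
  `(K̂,K̂')` of conjecture H absorb (memo §3).
-/

namespace Summit.CriticalPhenomena.PercolationContinuityZ3.Theorems.SahiE3ExchangeDom

open Finset SahiE3DimerPacking SahiE3ExchangeCross SahiE3ExchangeEmptyLayer SahiE3ExchangeNested
open scoped BigOperators

variable {B : Type*} [DecidableEq B]

/-- Traced union bound: for `w ≥ 0` and `K ∪ L ⊆ P`, `w(K∩V) + w(L∩V) ≤ w(P∩V) + w((K∩L)∩V)`. [folklore] -/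
theorem trace_union_le (w : B → ℝ) (hw : ∀ b, 0 ≤ w b) (V K L P : Finset B) (hKP : K ⊆ P) (hLP : L ⊆ P) :
    (∑ b ∈ K ∩ V, w b) + (∑ b ∈ L ∩ V, w b) ≤ (∑ b ∈ P ∩ V, w b) + ∑ b ∈ (K ∩ L) ∩ V, w b := by
  have hu := sum_union_trace w V K L
  have hsub : (K ∪ L) ∩ V ⊆ P ∩ V := Finset.inter_subset_inter (Finset.union_subset hKP hLP) le_rfl
  have hle : ∑ b ∈ (K ∪ L) ∩ V, w b ≤ ∑ b ∈ P ∩ V, w b := sum_le_sum_of_subset' w hw hsub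
  linarith

/-- **The exchange lemma from the DOM packing under conditional Harris on the slot.**  `w ≥ 0` with `0 < w(V) ≤ 1`; a
configuration `O ⊆ K∩L`, `K∪L ⊆ P`, `O' ⊆ K'∩L'`, `K'∪L' ⊆ P'`; the two dom inequalities `R(KK'V) ≥ a(KK'V)`,
`R(LL'V) ≥ a(LL'V)`; Harris with the slot for `K, L, K', L', P, P'` (`v·w(X) ≤ a(X)`); conditional Harris on the slot for the four
pairs `(K,K')`, `(L,L')`, `(P,P')`, `(O,O')` (`a(X)a(Y) ≤ v·a(X∩Y∩V)` — automatic for a principal slot); and any bracket value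
`Y ≥ 0`.  Then `X_a + R(KK'V) + R(LL'V) − need(K,L') − need(L,K') + (1−v)·Y ≥ 0`.  Both OR-peel brackets (type 2:
`Har(P,P') + (p−k)(p'−l') + (p−l)(p'−k')`; type 1: `Har(P,P') + (p−k)(k'−o') + (p−o)(p'−k')`) are nonnegative under the
nestings, so this is the exchange lemma (both types, all corner classes) for principal slots. [this work] -/
theorem exchange_of_dom (w R : B → ℝ) (hw : ∀ b, 0 ≤ w b)
    (V K L P O K' L' P' O' : Finset B) (Y : ℝ)
    (hv : 0 < ∑ b ∈ V, w b) (hv1 : ∑ b ∈ V, w b ≤ 1)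
    (hKP : K ⊆ P) (hLP : L ⊆ P) (hOK : O ⊆ K) (hOL : O ⊆ L)
    (hKP' : K' ⊆ P') (hLP' : L' ⊆ P') (hOK' : O' ⊆ K') (hOL' : O' ⊆ L')
    (hdomK : ∑ b ∈ (K ∩ K') ∩ V, w b ≤ ∑ b ∈ (K ∩ K') ∩ V, R b)
    (hdomL : ∑ b ∈ (L ∩ L') ∩ V, w b ≤ ∑ b ∈ (L ∩ L') ∩ V, R b)
    (hKV : (∑ b ∈ V, w b) * (∑ b ∈ K, w b) ≤ ∑ b ∈ K ∩ V, w b)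
    (hLV : (∑ b ∈ V, w b) * (∑ b ∈ L, w b) ≤ ∑ b ∈ L ∩ V, w b)
    (hK'V : (∑ b ∈ V, w b) * (∑ b ∈ K', w b) ≤ ∑ b ∈ K' ∩ V, w b)
    (hL'V : (∑ b ∈ V, w b) * (∑ b ∈ L', w b) ≤ ∑ b ∈ L' ∩ V, w b)
    (hPV : (∑ b ∈ V, w b) * (∑ b ∈ P, w b) ≤ ∑ b ∈ P ∩ V, w b)
    (hP'V : (∑ b ∈ V, w b) * (∑ b ∈ P', w b) ≤ ∑ b ∈ P' ∩ V, w b)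
    (hcK : (∑ b ∈ K ∩ V, w b) * (∑ b ∈ K' ∩ V, w b) ≤ (∑ b ∈ V, w b) * ∑ b ∈ (K ∩ K') ∩ V, w b)
    (hcL : (∑ b ∈ L ∩ V, w b) * (∑ b ∈ L' ∩ V, w b) ≤ (∑ b ∈ V, w b) * ∑ b ∈ (L ∩ L') ∩ V, w b)
    (hcP : (∑ b ∈ P ∩ V, w b) * (∑ b ∈ P' ∩ V, w b) ≤ (∑ b ∈ V, w b) * ∑ b ∈ (P ∩ P') ∩ V, w b)
    (hcO : (∑ b ∈ O ∩ V, w b) * (∑ b ∈ O' ∩ V, w b) ≤ (∑ b ∈ V, w b) * ∑ b ∈ (O ∩ O') ∩ V, w b)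
    (hY : 0 ≤ Y) :
    0 ≤ (∑ b ∈ (P ∩ P') ∩ V, w b) + (∑ b ∈ (O ∩ O') ∩ V, w b)
        - (∑ b ∈ P, w b) * (∑ b ∈ O' ∩ V, w b) - (∑ b ∈ P', w b) * (∑ b ∈ O ∩ V, w b)
        + (∑ b ∈ (K ∩ K') ∩ V, R b) + (∑ b ∈ (L ∩ L') ∩ V, R b)
        - ((∑ b ∈ K, w b) * (∑ b ∈ L' ∩ V, w b) + (∑ b ∈ L', w b) * (∑ b ∈ K ∩ V, w b)
            - (∑ b ∈ V, w b) * (∑ b ∈ K, w b) * (∑ b ∈ L', w b))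
        - ((∑ b ∈ L, w b) * (∑ b ∈ K' ∩ V, w b) + (∑ b ∈ K', w b) * (∑ b ∈ L ∩ V, w b)
            - (∑ b ∈ V, w b) * (∑ b ∈ L, w b) * (∑ b ∈ K', w b))
        + (1 - ∑ b ∈ V, w b) * Y := by
  -- traced union / nesting facts
  have hU := trace_union_le w hw V K L P hKP hLP
  have hU' := trace_union_le w hw V K' L' P' hKP' hLP'
  have hOM : ∑ b ∈ O ∩ V, w b ≤ ∑ b ∈ (K ∩ L) ∩ V, w b :=
    sum_le_sum_of_subset' w hw (Finset.inter_subset_inter (Finset.subset_inter hOK hOL) le_rfl)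
  have hOM' : ∑ b ∈ O' ∩ V, w b ≤ ∑ b ∈ (K' ∩ L') ∩ V, w b :=
    sum_le_sum_of_subset' w hw (Finset.inter_subset_inter (Finset.subset_inter hOK' hOL') le_rfl)
  have hMK : ∑ b ∈ (K ∩ L) ∩ V, w b ≤ ∑ b ∈ K ∩ V, w b :=
    sum_le_sum_of_subset' w hw (Finset.inter_subset_inter Finset.inter_subset_left le_rfl)
  have hML : ∑ b ∈ (K ∩ L) ∩ V, w b ≤ ∑ b ∈ L ∩ V, w b :=
    sum_le_sum_of_subset' w hw (Finset.inter_subset_inter Finset.inter_subset_right le_rfl)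
  have hMK' : ∑ b ∈ (K' ∩ L') ∩ V, w b ≤ ∑ b ∈ K' ∩ V, w b :=
    sum_le_sum_of_subset' w hw (Finset.inter_subset_inter Finset.inter_subset_left le_rfl)
  have hML' : ∑ b ∈ (K' ∩ L') ∩ V, w b ≤ ∑ b ∈ L' ∩ V, w b :=
    sum_le_sum_of_subset' w hw (Finset.inter_subset_inter Finset.inter_subset_right le_rfl)
  have haO0 : 0 ≤ ∑ b ∈ O ∩ V, w b := Finset.sum_nonneg fun b _ => hw b
  have haO'0 : 0 ≤ ∑ b ∈ O' ∩ V, w b := Finset.sum_nonneg fun b _ => hw b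
  -- abbreviations
  set v := ∑ b ∈ V, w b with hv_def
  set p := ∑ b ∈ P, w b
  set k := ∑ b ∈ K, w b
  set l := ∑ b ∈ L, w b
  set p' := ∑ b ∈ P', w b
  set k' := ∑ b ∈ K', w b
  set l' := ∑ b ∈ L', w b
  set aP := ∑ b ∈ P ∩ V, w b
  set aK := ∑ b ∈ K ∩ V, w b
  set aL := ∑ b ∈ L ∩ V, w b
  set aO := ∑ b ∈ O ∩ V, w b
  set aM := ∑ b ∈ (K ∩ L) ∩ V, w b
  set aP' := ∑ b ∈ P' ∩ V, w b
  set aK' := ∑ b ∈ K' ∩ V, w b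
  set aL' := ∑ b ∈ L' ∩ V, w b
  set aO' := ∑ b ∈ O' ∩ V, w b
  set aM' := ∑ b ∈ (K' ∩ L') ∩ V, w b
  set aPP := ∑ b ∈ (P ∩ P') ∩ V, w b
  set aOO := ∑ b ∈ (O ∩ O') ∩ V, w b
  set aKK := ∑ b ∈ (K ∩ K') ∩ V, w b
  set aLL := ∑ b ∈ (L ∩ L') ∩ V, w b
  set rKK := ∑ b ∈ (K ∩ K') ∩ V, R b
  set rLL := ∑ b ∈ (L ∩ L') ∩ V, R b
  -- |aK − aL| ≤ aP − aO and primed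
  have hD1 : aK - aL ≤ aP - aO := by linarith
  have hD2 : aL - aK ≤ aP - aO := by linarith
  have hD1' : aK' - aL' ≤ aP' - aO' := by linarith
  have hD2' : aL' - aK' ≤ aP' - aO' := by linarith
  -- nonnegative products
  have P1 : 0 ≤ (aP - aO + (aK - aL)) * (aP' - aO' + (aK' - aL')) := mul_nonneg (by linarith) (by linarith)
  have P2 : 0 ≤ (aP - aO - (aK - aL)) * (aP' - aO' - (aK' - aL')) := mul_nonneg (by linarith) (by linarith)
  have P3 : 0 ≤ (aK - v * k) * (aL' - v * l') := mul_nonneg (by linarith) (by linarith)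
  have P4 : 0 ≤ (aL - v * l) * (aK' - v * k') := mul_nonneg (by linarith) (by linarith)
  have P5 : v * p * aO' ≤ aP * aO' := by
    have := mul_le_mul_of_nonneg_right hPV haO'0; linarith
  have P6 : v * p' * aO ≤ aP' * aO := by
    have := mul_le_mul_of_nonneg_right hP'V haO0; linarith
  have P7 : 0 ≤ v * (rKK - aKK) := mul_nonneg hv.le (by linarith)
  have P8 : 0 ≤ v * (rLL - aLL) := mul_nonneg hv.le (by linarith)
  have P9 : 0 ≤ v * ((1 - v) * Y) := mul_nonneg hv.le (mul_nonneg (by linarith) hY)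
  -- v · (exchange expression) ≥ 0, then divide by v > 0
  have key : 0 ≤ v * (aPP + aOO - p * aO' - p' * aO + rKK + rLL
        - (k * aL' + l' * aK - v * k * l') - (l * aK' + k' * aL - v * l * k') + (1 - v) * Y) := by
    nlinarith [hcK, hcL, hcP, hcO, P1, P2, P3, P4, P5, P6, P7, P8, P9]
  exact (mul_nonneg_iff_of_pos_left hv).mp key

end Summit.CriticalPhenomena.PercolationContinuityZ3.Theorems.SahiE3ExchangeDom
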